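import Literature.MathematicalPhysics.QuantumManyBody.CubicTrialVectorCubicTerms
import HarnessLib

/-!
# The cutoff defect with the pair coincidences weighted

Topic `Literature/MathematicalPhysics/QuantumManyBody`, namespace `BoseGas.Fock`; theorem-only refinement
of `sum_mul_defect_le` (`CubicTrialVectorCubicTerms.lean`) for the provefact
`Literature.MathematicalPhysics.QuantumManyBody.BoseGas.BastiCenatiempoSchlein2021_upperBound`.

`sum_mul_defect_le` bounds the three-index ("pair") coincidences by `F₂K₁²` with `F₂` a supremum
over pairs `(τⱼ, τₖ)`. For the weights of §5 of [BastiCenatiempoSchlein2021] this supremum is too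
large: the constraint `e pⱼ + e pₖ + e b = 0` with `b ∈ P_S` forces the two hard modes to be almost
antipodal, which is only visible after summing against the product weights `|κ_{τⱼ}|²|κ_{τₖ}|²`
(the bounds for `W₃, W₄` and `X₂` in [ibid., §5.2–§5.3]). Here the pair coincidences are therefore
kept weighted: with `h₂(τⱼ,τₖ) = ∑_τ [C₂(τ,τⱼ,τₖ)] g_τ`,

`∑_τ g_τ D_τ ≤ (F₁K₁ + F₂')‖ξ_ν‖²`, `F₂' ≥ ∑_{τⱼ,τₖ} |κ_{τⱼ}|²|κ_{τₖ}|² h₂(τⱼ,τₖ)`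

(`sum_mul_defect_le_weighted`), by two weighted removals of a distinguished triple
(`sum_normSq_setCoeff_mul_sum_mul_le`, `sum_normSq_setCoeff_mul_sum_le`).

## References

* [BastiCenatiempoSchlein2021] G. Basti, S. Cenatiempo, B. Schlein, Forum Math. Sigma 9 (2021) e74,
  arXiv:2101.06222: §5.1 (5.3)–(5.4), §5.2 (5.15)–(5.17), §5.3 (W₃, W₄).
-/

noncomputable section

namespace Literature.MathematicalPhysics.QuantumManyBody.BoseGas

open Complex MvPolynomial Finset
open scoped ComplexConjugate BigOperators

namespace Fock

variable {ι : Type*} [DecidableEq ι] [LinearOrder ι] {e : ι → Momentum} {PH PS : Finset ι}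

/-- **Weighted pair removal**: for a hereditary family, non-negative pair weights `w` and the set
weights `|c_S|²`, `∑_S |c_S|² ∑_{τⱼ∈S} ∑_{τₖ∈S∖τⱼ} w(τⱼ,τₖ) ≤ (∑_{τⱼ,τₖ} w(τⱼ,τₖ)|κ_{τⱼ}|²|κ_{τₖ}|²) ∑_S |c_S|²`.
[cite: BastiCenatiempoSchlein2021, §5.1 (5.3)–(5.4) (two removals)] -/
theorem sum_normSq_setCoeff_mul_sum_sum_le [Fintype ι] (κ : Triple e PH PS → ℂ)
    (w : Triple e PH PS → Triple e PH PS → ℝ) (hw : ∀ τj τk, 0 ≤ w τj τk) :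
    ∑ S : Finset (Triple e PH PS), ‖setCoeff κ (TripleAdm e) S‖ ^ 2 * ∑ τj ∈ S, ∑ τk ∈ S.erase τj, w τj τk ≤
      (∑ τj, ∑ τk, w τj τk * ‖κ τj‖ ^ 2 * ‖κ τk‖ ^ 2) * ∑ S : Finset (Triple e PH PS), ‖setCoeff κ (TripleAdm e) S‖ ^ 2 := by
  classical
  have hher : ∀ S : Finset (Triple e PH PS), TripleAdm e S → ∀ τ ∈ S, TripleAdm e (S.erase τ) :=
    fun S hS τ _ => hS.erase τ
  set c : Finset (Triple e PH PS) → ℝ := fun S => ‖setCoeff κ (TripleAdm e) S‖ ^ 2 with hc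
  -- step 1: exchange the sums over `S` and `τj`
  have h1 : ∑ S : Finset (Triple e PH PS), c S * ∑ τj ∈ S, ∑ τk ∈ S.erase τj, w τj τk =
      ∑ τj : Triple e PH PS, ∑ S : Finset (Triple e PH PS), (if τj ∈ S then c S * ∑ τk ∈ S.erase τj, w τj τk else 0) := by
    rw [Finset.sum_comm]
    refine Finset.sum_congr rfl fun S _ => ?_
    rw [Finset.mul_sum, ← Finset.sum_filter]
    congr 1
    ext τj; simp
  -- step 2: for each `τj`, two removals
  have h2 : ∀ τj : Triple e PH PS, ∑ S : Finset (Triple e PH PS), (if τj ∈ S then c S * ∑ τk ∈ S.erase τj, w τj τk else 0) ≤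
      ‖κ τj‖ ^ 2 * ((∑ τk, w τj τk * ‖κ τk‖ ^ 2) * ∑ S : Finset (Triple e PH PS), c S) := by
    intro τj
    have hA := sum_normSq_setCoeff_mul_sum_mul_le (κ := κ) hher (fun τ => if τ = τj then (1 : ℝ) else 0)
      (fun τ => by split_ifs <;> norm_num) (fun S' => ∑ τk ∈ S', w τj τk) (fun S' => Finset.sum_nonneg fun τk _ => hw τj τk)
    have hL : ∑ S : Finset (Triple e PH PS), (if τj ∈ S then c S * ∑ τk ∈ S.erase τj, w τj τk else 0) =
        ∑ S : Finset (Triple e PH PS), ‖setCoeff κ (TripleAdm e) S‖ ^ 2 *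
          ∑ τ ∈ S, (if τ = τj then (1 : ℝ) else 0) * ∑ τk ∈ S.erase τ, w τj τk := by
      refine Finset.sum_congr rfl fun S _ => ?_
      by_cases hS : τj ∈ S
      · rw [if_pos hS, Finset.sum_eq_single_of_mem τj hS (fun τ _ hne => by rw [if_neg hne, zero_mul]), if_pos rfl, one_mul]
      · rw [if_neg hS, Finset.sum_eq_zero (fun τ hτ => by rw [if_neg (fun h : τ = τj => hS (h ▸ hτ)), zero_mul]), mul_zero]
    have hR : ∑ τ : Triple e PH PS, (if τ = τj then (1 : ℝ) else 0) * ‖κ τ‖ ^ 2 *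
        ∑ S : Finset (Triple e PH PS), ‖setCoeff κ (TripleAdm e) S‖ ^ 2 * ∑ τk ∈ S, w τj τk =
        ‖κ τj‖ ^ 2 * ∑ S : Finset (Triple e PH PS), ‖setCoeff κ (TripleAdm e) S‖ ^ 2 * ∑ τk ∈ S, w τj τk := by
      rw [Finset.sum_eq_single τj (fun τ _ hne => by rw [if_neg hne, zero_mul, zero_mul]) (fun h => absurd (Finset.mem_univ τj) h),
        if_pos rfl, one_mul]
    rw [hL]
    refine hA.trans ?_
    rw [hR]
    have hB := sum_normSq_setCoeff_mul_sum_le (κ := κ) hher (fun τk => w τj τk) (fun τk => hw τj τk)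
    exact mul_le_mul_of_nonneg_left hB (sq_nonneg _)
  -- step 3: sum over `τj`
  rw [h1]
  calc _ ≤ ∑ τj : Triple e PH PS, ‖κ τj‖ ^ 2 * ((∑ τk, w τj τk * ‖κ τk‖ ^ 2) * ∑ S : Finset (Triple e PH PS), c S) :=
        Finset.sum_le_sum fun τj _ => h2 τj
    _ = _ := by
        rw [Finset.sum_mul]
        refine Finset.sum_congr rfl fun τj _ => ?_
        rw [Finset.sum_mul, Finset.sum_mul, Finset.mul_sum]
        exact Finset.sum_congr rfl fun τk _ => by ring

/-- **The coincidence bound for the cutoff error, pair coincidences weighted.** As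
`sum_mul_defect_le`, but with the three-index sums kept under the product weights:
`∑_τ g_τ D_τ ≤ (F₁K₁ + F₂')‖ξ_ν‖²` whenever `F₁` bounds `∑_τ [C₁(τ,τ')] g_τ` uniformly in `τ'` and
`F₂' ≥ ∑_{τⱼ,τₖ} |κ_{τⱼ}|²|κ_{τₖ}|² ∑_τ [C₂(τ,τⱼ,τₖ)] g_τ`.
[cite: BastiCenatiempoSchlein2021, §5.2 (5.15)–(5.17), §5.3 (W₃, W₄)] -/
theorem sum_mul_defect_le_weighted [Fintype ι] (he : Function.Injective e) (κ : Triple e PH PS → ℂ)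
    (g : Triple e PH PS → ℝ) (hg : ∀ τ, 0 ≤ g τ) {F₁ F₂ : ℝ} (hF₁ : 0 ≤ F₁)
    (hF₁le : ∀ τ' : Triple e PH PS, ∑ τ : Triple e PH PS,
      (if τ.b = τ'.b ∨ (∃ p, (p = τ.u ∨ p = τ.a) ∧ (p = τ'.u ∨ p = τ'.a)) ∨
          (∃ p, (p = τ.u ∨ p = τ.a) ∧ e p + e p + e τ'.b = 0) ∨ (∃ p', (p' = τ'.u ∨ p' = τ'.a) ∧ e p' + e p' + e τ.b = 0)
        then g τ else 0) ≤ F₁)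
    (hF₂le : ∑ τj : Triple e PH PS, ∑ τk : Triple e PH PS, ‖κ τj‖ ^ 2 * ‖κ τk‖ ^ 2 * ∑ τ : Triple e PH PS,
      (if (∃ pj pk, (pj = τj.u ∨ pj = τj.a) ∧ (pk = τk.u ∨ pk = τk.a) ∧ e pj + e pk + e τ.b = 0) ∨
          (∃ p pk, (p = τ.u ∨ p = τ.a) ∧ (pk = τk.u ∨ pk = τk.a) ∧ e p + e pk + e τj.b = 0)
        then g τ else 0) ≤ F₂) :
    ∑ τ : Triple e PH PS, g τ * ∑ S : Finset (Triple e PH PS),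
        (if TripleAdm e S ∧ (τ ∈ S ∨ ¬ TripleAdm e (insert τ S)) then ‖setCoeff κ (TripleAdm e) S‖ ^ 2 else 0) ≤
      (F₁ * (∑ τ, ‖κ τ‖ ^ 2) + F₂) * ∑ S : Finset (Triple e PH PS), ‖setCoeff κ (TripleAdm e) S‖ ^ 2 := by
  classical
  set C₁ : Triple e PH PS → Triple e PH PS → Prop := fun τ τ' =>
    τ.b = τ'.b ∨ (∃ p, (p = τ.u ∨ p = τ.a) ∧ (p = τ'.u ∨ p = τ'.a)) ∨
      (∃ p, (p = τ.u ∨ p = τ.a) ∧ e p + e p + e τ'.b = 0) ∨ (∃ p', (p' = τ'.u ∨ p' = τ'.a) ∧ e p' + e p' + e τ.b = 0)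
    with hC₁
  set C₂ : Triple e PH PS → Triple e PH PS → Triple e PH PS → Prop := fun τ τj τk =>
    (∃ pj pk, (pj = τj.u ∨ pj = τj.a) ∧ (pk = τk.u ∨ pk = τk.a) ∧ e pj + e pk + e τ.b = 0) ∨
      (∃ p pk, (p = τ.u ∨ p = τ.a) ∧ (pk = τk.u ∨ pk = τk.a) ∧ e p + e pk + e τj.b = 0) with hC₂
  set c : Finset (Triple e PH PS) → ℝ := fun S => ‖setCoeff κ (TripleAdm e) S‖ ^ 2 with hc
  have hh₂0 : ∀ τj τk, 0 ≤ ∑ τ : Triple e PH PS, (if C₂ τ τj τk then g τ else 0) := fun τj τk =>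
    Finset.sum_nonneg fun τ _ => by split_ifs <;> [exact hg τ; exact le_rfl]
  -- swap the sums
  have hswap : ∑ τ : Triple e PH PS, g τ * ∑ S : Finset (Triple e PH PS),
      (if TripleAdm e S ∧ (τ ∈ S ∨ ¬ TripleAdm e (insert τ S)) then c S else 0) =
      ∑ S : Finset (Triple e PH PS), c S * ∑ τ : Triple e PH PS,
        (if TripleAdm e S ∧ (τ ∈ S ∨ ¬ TripleAdm e (insert τ S)) then g τ else 0) := by
    simp only [Finset.mul_sum, mul_ite, mul_zero]
    rw [Finset.sum_comm]
    refine Finset.sum_congr rfl fun S _ => Finset.sum_congr rfl fun τ _ => ?_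
    split_ifs
    · ring
    · rfl
  rw [hswap]
  -- per-set bound: `|S| F₁ + ∑_{τj∈S}∑_{τk∈S∖τj} h₂(τj,τk)`
  have hSle : ∀ S : Finset (Triple e PH PS), ∑ τ : Triple e PH PS,
      (if TripleAdm e S ∧ (τ ∈ S ∨ ¬ TripleAdm e (insert τ S)) then g τ else 0) ≤
      (S.card : ℝ) * F₁ + ∑ τj ∈ S, ∑ τk ∈ S.erase τj, (∑ τ : Triple e PH PS, (if C₂ τ τj τk then g τ else 0)) := by
    intro S
    have hpair0 : 0 ≤ ∑ τj ∈ S, ∑ τk ∈ S.erase τj, (∑ τ : Triple e PH PS, (if C₂ τ τj τk then g τ else 0)) :=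
      Finset.sum_nonneg fun τj _ => Finset.sum_nonneg fun τk _ => hh₂0 τj τk
    by_cases hA : TripleAdm e S
    · have hpt : ∀ τ : Triple e PH PS, (if TripleAdm e S ∧ (τ ∈ S ∨ ¬ TripleAdm e (insert τ S)) then g τ else 0) ≤
          (∑ τ' ∈ S, (if C₁ τ τ' then g τ else 0)) + ∑ τj ∈ S, ∑ τk ∈ S.erase τj, (if C₂ τ τj τk then g τ else 0) := by
        intro τ
        have h1 : 0 ≤ ∑ τ' ∈ S, (if C₁ τ τ' then g τ else 0) :=
          Finset.sum_nonneg fun τ' _ => by split_ifs <;> [exact hg τ; exact le_rfl]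
        have h2 : 0 ≤ ∑ τj ∈ S, ∑ τk ∈ S.erase τj, (if C₂ τ τj τk then g τ else 0) :=
          Finset.sum_nonneg fun τj _ => Finset.sum_nonneg fun τk _ => by split_ifs <;> [exact hg τ; exact le_rfl]
        split_ifs with h
        · rcases hA.coincidence_of_incompatible he h.2 with ⟨τ', hτ'S, hc1⟩ | ⟨τj, hj, τk, hk, hjk, hc2⟩
          · have hle : g τ ≤ ∑ τ' ∈ S, (if C₁ τ τ' then g τ else 0) := by
              have := Finset.single_le_sum (f := fun τ' => if C₁ τ τ' then g τ else 0)
                (fun τ' _ => by split_ifs <;> [exact hg τ; exact le_rfl]) hτ'S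
              simp only [hC₁, if_pos hc1] at this ⊢
              exact this
            linarith
          · have hle : g τ ≤ ∑ τj ∈ S, ∑ τk ∈ S.erase τj, (if C₂ τ τj τk then g τ else 0) := by
              have hk' : τk ∈ S.erase τj := Finset.mem_erase.2 ⟨hjk.symm, hk⟩
              have i1 := Finset.single_le_sum (f := fun τk => if C₂ τ τj τk then g τ else 0)
                (fun τk _ => by split_ifs <;> [exact hg τ; exact le_rfl]) hk'
              have i2 := Finset.single_le_sum (f := fun τj => ∑ τk ∈ S.erase τj, (if C₂ τ τj τk then g τ else 0))
                (fun τj _ => Finset.sum_nonneg fun τk _ => by split_ifs <;> [exact hg τ; exact le_rfl]) hj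
              simp only [hC₂, if_pos hc2] at i1 i2 ⊢
              exact le_trans i1 i2
            linarith
        · linarith
      calc ∑ τ : Triple e PH PS, (if TripleAdm e S ∧ (τ ∈ S ∨ ¬ TripleAdm e (insert τ S)) then g τ else 0)
          ≤ ∑ τ : Triple e PH PS, ((∑ τ' ∈ S, (if C₁ τ τ' then g τ else 0)) +
              ∑ τj ∈ S, ∑ τk ∈ S.erase τj, (if C₂ τ τj τk then g τ else 0)) := Finset.sum_le_sum fun τ _ => hpt τ
        _ = (∑ τ' ∈ S, ∑ τ : Triple e PH PS, (if C₁ τ τ' then g τ else 0)) +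
              ∑ τj ∈ S, ∑ τk ∈ S.erase τj, ∑ τ : Triple e PH PS, (if C₂ τ τj τk then g τ else 0) := by
            rw [Finset.sum_add_distrib, Finset.sum_comm]
            congr 1
            rw [Finset.sum_comm]
            exact Finset.sum_congr rfl fun τj _ => Finset.sum_comm
        _ ≤ (∑ τ' ∈ S, F₁) + ∑ τj ∈ S, ∑ τk ∈ S.erase τj, (∑ τ : Triple e PH PS, (if C₂ τ τj τk then g τ else 0)) :=
            add_le_add (Finset.sum_le_sum fun τ' _ => hF₁le τ') le_rfl
        _ = (S.card : ℝ) * F₁ + ∑ τj ∈ S, ∑ τk ∈ S.erase τj, (∑ τ : Triple e PH PS, (if C₂ τ τj τk then g τ else 0)) := by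
            rw [Finset.sum_const, nsmul_eq_mul]
    · have h0 : ∑ τ : Triple e PH PS, (if TripleAdm e S ∧ (τ ∈ S ∨ ¬ TripleAdm e (insert τ S)) then g τ else 0) = 0 :=
        Finset.sum_eq_zero fun τ _ => if_neg (fun h => hA h.1)
      rw [h0]
      nlinarith [hpair0, Nat.cast_nonneg (α := ℝ) S.card]
  -- sum over `S`
  have hher : ∀ S : Finset (Triple e PH PS), TripleAdm e S → ∀ τ ∈ S, TripleAdm e (S.erase τ) :=
    fun S hS τ _ => hS.erase τ
  have hm1 := sum_normSq_setCoeff_mul_sum_le (κ := κ) hher (fun _ => 1) (fun _ => zero_le_one)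
  simp only [one_mul, Finset.sum_const, nsmul_eq_mul, mul_one] at hm1
  have hm2 := sum_normSq_setCoeff_mul_sum_sum_le κ (fun τj τk => ∑ τ : Triple e PH PS, (if C₂ τ τj τk then g τ else 0)) hh₂0
  have hm2' : (∑ τj, ∑ τk, (∑ τ : Triple e PH PS, (if C₂ τ τj τk then g τ else 0)) * ‖κ τj‖ ^ 2 * ‖κ τk‖ ^ 2) ≤ F₂ := by
    refine le_trans (le_of_eq ?_) hF₂le
    exact Finset.sum_congr rfl fun τj _ => Finset.sum_congr rfl fun τk _ => by ring
  have hc0 : 0 ≤ ∑ S : Finset (Triple e PH PS), c S := Finset.sum_nonneg fun S _ => sq_nonneg _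
  calc ∑ S : Finset (Triple e PH PS), c S * ∑ τ : Triple e PH PS,
        (if TripleAdm e S ∧ (τ ∈ S ∨ ¬ TripleAdm e (insert τ S)) then g τ else 0)
      ≤ ∑ S : Finset (Triple e PH PS), c S * ((S.card : ℝ) * F₁ + ∑ τj ∈ S, ∑ τk ∈ S.erase τj, (∑ τ : Triple e PH PS, (if C₂ τ τj τk then g τ else 0))) :=
        Finset.sum_le_sum fun S _ => mul_le_mul_of_nonneg_left (hSle S) (sq_nonneg _)
    _ = F₁ * ∑ S : Finset (Triple e PH PS), c S * (S.card : ℝ) +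
          ∑ S : Finset (Triple e PH PS), c S * ∑ τj ∈ S, ∑ τk ∈ S.erase τj, (∑ τ : Triple e PH PS, (if C₂ τ τj τk then g τ else 0)) := by
        rw [Finset.mul_sum, ← Finset.sum_add_distrib]
        exact Finset.sum_congr rfl fun S _ => by ring
    _ ≤ F₁ * ((∑ τ, ‖κ τ‖ ^ 2) * ∑ S : Finset (Triple e PH PS), c S) +
          (∑ τj, ∑ τk, (∑ τ : Triple e PH PS, (if C₂ τ τj τk then g τ else 0)) * ‖κ τj‖ ^ 2 * ‖κ τk‖ ^ 2) * ∑ S : Finset (Triple e PH PS), c S :=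
        add_le_add (mul_le_mul_of_nonneg_left hm1 hF₁) hm2
    _ ≤ F₁ * ((∑ τ, ‖κ τ‖ ^ 2) * ∑ S : Finset (Triple e PH PS), c S) + F₂ * ∑ S : Finset (Triple e PH PS), c S :=
        add_le_add le_rfl (mul_le_mul_of_nonneg_right hm2' hc0)
    _ = _ := by ring

end Fock

end Literature.MathematicalPhysics.QuantumManyBody.BoseGas

end
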